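import Literature.AlgebraicGeometry.Resolution.CentreBlowupMohStability
import Literature.AlgebraicGeometry.Resolution.PointBlowupNearRidge
import Summits.ResolutionOfSingularities.ResolutionOfSingularities.Theorems.MarkedTransferCampaignW46MohWindowShade
import HarnessLib

/-!
# [OURS · L1 W4.6] Rung (iii) "Moh window" for the classical pair — the TERMINAL case under the blow-up of
  a permissible coordinate centre: stability (every centre), strict drop of the order (minimal centre),
  all dimensions

Cell `res-hironaka`, rung L, slot W4.6, seat `res-L1-s46-pv-6` (gen 2).  Companion of
`MarkedTransferCampaignW46MohWindowShadeTerminal.lean` (point blow-ups: in the terminal =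
coordinate-monomial case inside the window, either a PROPER set of exceptional components has total
multiplicity `≥ p` — a positive-dimensional permissible coordinate centre — or `|r| = ord₀ F` drops at
every equimultiple point) and of gen 0's `MarkedTransferCampaignW46MohWindowShadeCentres.lean` (no shade
increase under Moh-permissible coordinate centres inside the window).  This file treats the first branch
of that dichotomy with the centre the classical procedure uses: a MINIMAL `S ⊆ σ` with
`Σ_{i∈S} r_i ≥ p` ("combinatorial resolution … the locus where the invariant attains its maximal value
defines a permissible center and it strictly decreases when this center is blown up",
[HauserPerlega2024, §3 (2)]; Bierstone–Milman's Case B, [BierstoneMilman2008, §5 Step I]).  Model: the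
tree's coordinate-centre walk `CentreBlowup.CState/step/newMult/IsEquimultiplePoint` of
`PointBlowupShadeCentres.lean` (blow-up of `C_S = {x = 0, y_i = 0 (i ∈ S)}`, chart `y_j`, `j ∈ S`,
point `b` of the fibre over the origin: `b_j = 0`, `b_i = 0` off `S`; [HauserPerlega2019PRIMS, §2]).
A TERMINAL state is `y^r ∣ F` with `ord₀ F = |r|` (shade `0`); it is then Moh-permissible for every
`S` (`ord_{C_S} F = degIn S r`, tree `CentreBlowup.ordAlong_eq_of_perm`).  OURS; replaces — for regime
(iii) of RESCUE-SEED W4.6, the classical pair and the terminal case — the ROLE of Th. 16.6 (2) /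
Eq. (127) (ms. p. 84 l. 4–20, «any smooth closed irreducible subscheme `D` of `∇(E)` such that the blowup
… is permissible») and of the termination clause of Th. 16.13 (p. 87 l. 25–29); NOT a statement of the
manuscript [claim: Hironaka2017, status: under-review], nothing of which is used.  AI review is weaker
than expert review.

## What is proved (prime `p`, field `K` of char. `p`, finite `σ`; terminal state, `j ∈ S`, `Σ_S r_i ≥ p`,
## point `b` over the origin)

* `coeff_newMult_pointTransform_ne_zero`: the new exceptional monomial `y^{r'}`, `r' = newMult`
  (`r'_j = Σ_S r_i − p`, old components kept iff `b_i = 0`), occurs in the translated chart transform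
  with coefficient `c · ∏_{b_i ≠ 0} b_i^{r_i} ≠ 0`.
* INSIDE THE WINDOW (`p < |r| < 2p`), for EVERY permissible coordinate centre:
  `not_isPthPowerExponent_step_r` — `y^{r'}` is not a `p`-th power, so it survives the cleaning
  (`coeff_newMult_step_ne_zero`); `ordZero_step_eq`, `shade_step_eq_zero` — the new state is terminal
  again (STABILITY; the companion's point case is `S` = all variables, tree
  `CentreBlowup.step_univ_toState`); `step_r_ne_zero`, `isEquimultiplePoint_iff` — the point is
  equimultiple iff `p ≤ |r'|`.
* MINIMALITY at the chart index (`Σ_{S∖{j}} r < p`): `degree_step_r_lt` — `|r'| < |r|`: THE ORDER DROPS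
  at every point over the origin, equimultiple or not ("it strictly decreases when this center is blown
  up").
* The bottom edge `|r| = p` and the resulting TERMINATION of walks of minimal centres are in the sequel
  `MarkedTransferCampaignW46MohWindowShadeTerminalCentresExit.lean`.

Honest scope: given coordinates (terminal = coordinate-monomial); points over the origin of the centre
only (other points of `C_S` are other states of the atlas); `e = 1`.  Barriers:
`ResidualOrderUnboundedNarrow.mohStability_fails_for_each_e` (`e ≥ 3`); `PointBlowupMohBoundAttained`
(the monomial kangaroo at `|r| = 2p`, excluded by the window exactly in `not_isPthPowerExponent_step_r`).
-/

noncomputable section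

set_option linter.dupNamespace false -- mandated namespace of this single-conjunct summit

open MvPolynomial Finset

open scoped BigOperators

namespace Summit.ResolutionOfSingularities.ResolutionOfSingularities.Theorems.CampaignW46.MohWindowShadeTerminalCentres

open Literature.AlgebraicGeometry.Resolution
open Literature.AlgebraicGeometry.Resolution.CentreBlowup
open Literature.AlgebraicGeometry.Resolution.Hauser2010
open Literature.AlgebraicGeometry.Resolution.HauserPerlega2019 (initialForm)
open Literature.Barriers.ResolutionOfSingularities (ordZero_le_of_coeff_ne_zero le_ordZero_of_forall)

variable {σ : Type*} {K : Type*} [Field K] [Fintype σ] [DecidableEq σ] [DecidableEq K]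
variable (p : ℕ) [hp : Fact p.Prime] [CharP K p]

/-! ## §1. Terminal states are Moh-permissible for every coordinate centre -/

omit [Fintype σ] [DecidableEq σ] [DecidableEq K] hp [CharP K p] in
/-- A terminal state (`y^r ∣ F`, `ord₀ F = |r|`) satisfies Moh's permissibility inequality
`degIn S r + shade ≤ degIn S d` on its support for EVERY `S` (shade `0`). [folklore] -/
theorem perm_of_terminal (S : Finset σ) (s : CState σ K) (hr : ∀ d ∈ s.F.support, s.r ≤ d) :
    ∀ d ∈ s.F.support, degIn S s.r + (s.r.degree - s.r.degree) ≤ degIn S d := by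
  intro d hd
  rw [Nat.sub_self, add_zero]
  exact degIn_le_degIn_of_le S (hr d hd)

omit hp [CharP K p] in
/-- The new multiplicities after the blow-up of `C_S` at a terminal state, pointwise:
`r'_k = (if b_k = 0 then (if k = j then Σ_S r − p else r_k) else 0)`. [folklore] -/
theorem step_r_apply (S : Finset σ) (j : σ) (b : σ → K) (hbj : b j = 0) (s : CState σ K)
    (hr : ∀ d ∈ s.F.support, s.r ≤ d) (hord : ordZero s.F = (s.r.degree : ℕ)) (k : σ) :
    (step p S j b s).r k = if b k = 0 then (if k = j then degIn S s.r - p else s.r k) else 0 := by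
  rw [step_r_eq p S j b hbj s hord hr (perm_of_terminal S s hr), Finsupp.filter_apply,
    Finsupp.update_apply, Nat.sub_self, add_zero]

omit [DecidableEq σ] [DecidableEq K] hp [CharP K p] in
/-- In a terminal state the exceptional monomial `y^r` occurs in `F`. [folklore] -/
theorem coeff_r_ne_zero (s : CState σ K) (hr : ∀ d ∈ s.F.support, s.r ≤ d)
    (hord : ordZero s.F = (s.r.degree : ℕ)) : coeff s.r s.F ≠ 0 := by
  obtain ⟨⟨d, hd, hdeg⟩, -⟩ := (ordZero_eq_nat_iff _ _).mp hord
  have hle : s.r ≤ d := hr d (MvPolynomial.mem_support_iff.mpr hd)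
  by_contra h0
  have hne : s.r ≠ d := by rintro h; rw [h] at h0; exact hd h0
  have := PointBlowup.degree_lt_degree_of_lt (lt_of_le_of_ne hle hne)
  omega

/-! ## §2. The new exceptional monomial occurs in the transform -/

omit hp [CharP K p] in
/-- **[OURS · L1 W4.6] The new exceptional monomial occurs in the centre transform.**  For a terminal
state, `j ∈ S`, `Σ_S r_i ≥ p`, and a point `b` over the origin (`b_j = 0`, `b_i = 0` off `S`), the monomial
`y^{r'}`, `r' = newMult`, has coefficient `c · ∏_{b_i ≠ 0} b_i^{r_i} ≠ 0` in the translated chart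
transform.  NOT a statement of the manuscript. [folklore] -/
theorem coeff_newMult_pointTransform_ne_zero {S : Finset σ} {j : σ} (hj : j ∈ S) (b : σ → K)
    (hbj : b j = 0) (hbN : ∀ i, i ∉ S → b i = 0) (s : CState σ K)
    (hr : ∀ d ∈ s.F.support, s.r ≤ d) (hord : ordZero s.F = (s.r.degree : ℕ))
    (hS : p ≤ degIn S s.r) : coeff (step p S j b s).r (pointTransform p S j b s) ≠ 0 := by
  classical
  have hc : coeff s.r s.F ≠ 0 := coeff_r_ne_zero s hr hord
  have hrF : s.r ∈ s.F.support := MvPolynomial.mem_support_iff.mpr hc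
  have hce : ∀ (d : σ →₀ ℕ) (i : σ),
      chartExponent p S j d i = if i = j then degIn S d - p else d i := by
    intro d i; unfold chartExponent; rw [Finsupp.update_apply]
  rw [pointTransform_eq_sum, coeff_sum, Finset.sum_eq_single_of_mem s.r hrF]
  · rw [WeightedBlowup.coeff_translate_monomial]
    refine mul_ne_zero hc ?_
    rw [Finset.prod_ne_zero_iff]
    intro i _
    by_cases hbi : b i = 0
    · have h1 : (step p S j b s).r i = chartExponent p S j s.r i := by
        rw [step_r_apply p S j b hbj s hr hord i, hce, if_pos hbi]
      rw [h1, Nat.choose_self, Nat.sub_self, pow_zero, Nat.cast_one, mul_one]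
      exact one_ne_zero
    · have hij : i ≠ j := by rintro rfl; exact hbi hbj
      have h1 : (step p S j b s).r i = 0 := by
        rw [step_r_apply p S j b hbj s hr hord i, if_neg hbi]
      rw [h1, Nat.choose_zero_right, Nat.sub_zero, Nat.cast_one, one_mul, hce, if_neg hij]
      exact pow_ne_zero _ hbi
  · intro d hd hne
    by_contra h
    apply hne
    -- every coordinate of `d` is determined: `d = r`
    have hle : s.r ≤ d := hr d hd
    have hS' : degIn S s.r ≤ degIn S d := degIn_le_degIn_of_le S hle
    have hj' := PointBlowup.apply_eq_of_coeff_translate_monomial_ne_zero b hbj h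
    rw [step_r_apply p S j b hbj s hr hord j, if_pos hbj, if_pos rfl, hce, if_pos rfl] at hj'
    have hdeg : degIn S d = degIn S s.r := by omega
    -- in `S`: termwise `≤` with equal sums
    have hinS : ∀ i ∈ S, d i = s.r i := by
      intro i hi
      by_contra hne'
      have hlt : s.r i < d i := lt_of_le_of_ne (Finsupp.le_def.mp hle i) (Ne.symm hne')
      have : degIn S s.r < degIn S d := by
        unfold degIn
        exact Finset.sum_lt_sum (fun k _ => Finsupp.le_def.mp hle k) ⟨i, hi, hlt⟩
      omega
    ext i
    by_cases hi : i ∈ S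
    · exact hinS i hi
    · have hij : i ≠ j := by rintro rfl; exact hi hj
      have h2 := PointBlowup.apply_eq_of_coeff_translate_monomial_ne_zero b (hbN i hi) h
      rw [step_r_apply p S j b hbj s hr hord i, if_pos (hbN i hi), if_neg hij, hce, if_neg hij] at h2
      exact h2.symm

/-! ## §3. Minimal centres inside the window -/

omit hp [CharP K p] in
/-- **[OURS · L1 W4.6] Inside the window the new exceptional monomial is not a `p`-th power — for EVERY
permissible coordinate centre.**  If `p < |r| < 2p` and `Σ_S r ≥ p`, then `r' = newMult` at any point
over the origin is not a `p`-th power exponent, so `y^{r'}` survives the cleaning.  (`r'_j = Σ_S r − p`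
is `< p`, so it would vanish: `Σ_S r = p`; the multiplicities off `S` are kept, would be divisible by
`p`, and sum to `|r| − p < p`: they would vanish too, giving `|r| = p`.)  At `|r| = 2p` this fails — the
monomial kangaroo `r = (p−1, p+1)`, `S` = both, of `PointBlowupMohBoundAttained`.  NOT a statement of the
manuscript. [folklore] -/
theorem not_isPthPowerExponent_step_r {S : Finset σ} {j : σ} (hj : j ∈ S) (b : σ → K)
    (hbj : b j = 0) (hbN : ∀ i, i ∉ S → b i = 0) (s : CState σ K)
    (hr : ∀ d ∈ s.F.support, s.r ≤ d) (hord : ordZero s.F = (s.r.degree : ℕ))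
    (hlo : p < s.r.degree) (hhi : s.r.degree < 2 * p) (hS : p ≤ degIn S s.r) :
    ¬ IsPthPowerExponent p (step p S j b s).r := by
  classical
  intro hP
  rw [isPthPowerExponent_iff] at hP
  have hr' := step_r_apply p S j b hbj s hr hord
  have hSle : degIn S s.r ≤ s.r.degree := degIn_le_degree S s.r
  -- `r'_j = Σ_S r − p` is divisible by `p` and `< p`, hence `Σ_S r = p`
  have hj0 : degIn S s.r = p := by
    have h := hP j
    rw [hr' j, if_pos hbj, if_pos rfl] at h
    rcases Nat.eq_zero_or_pos (degIn S s.r - p) with h0 | hpos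
    · omega
    · have := Nat.le_of_dvd hpos h; omega
  -- the kept multiplicities off `S` are divisible by `p` and sum to `|r| − p < p`: all zero
  have hcompl := degIn_add_sum_compl S s.r
  have hoff : ∀ i, i ∉ S → s.r i = 0 := by
    intro i hi
    have hij : i ≠ j := by rintro rfl; exact hi hj
    have h := hP i
    rw [hr' i, if_pos (hbN i hi), if_neg hij] at h
    have hle : s.r i ≤ ∑ k ∈ Sᶜ, s.r k :=
      Finset.single_le_sum (fun k _ => Nat.zero_le (s.r k)) (Finset.mem_compl.mpr hi)
    rcases Nat.eq_zero_or_pos (s.r i) with h0 | hpos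
    · exact h0
    · have := Nat.le_of_dvd hpos h; omega
  have hsum0 : ∑ k ∈ Sᶜ, s.r k = 0 :=
    Finset.sum_eq_zero fun k hk => hoff k (Finset.mem_compl.mp hk)
  -- hence `|r| = Σ_S r = p`, contradicting `p < |r|`
  omega

omit hp [CharP K p] in
/-- **[OURS · L1 W4.6] … hence it occurs in the cleaned transform.**  NOT a statement of the manuscript.
[folklore] -/
theorem coeff_newMult_step_ne_zero {S : Finset σ} {j : σ} (hj : j ∈ S) (b : σ → K)
    (hbj : b j = 0) (hbN : ∀ i, i ∉ S → b i = 0) (s : CState σ K)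
    (hr : ∀ d ∈ s.F.support, s.r ≤ d) (hord : ordZero s.F = (s.r.degree : ℕ))
    (hlo : p < s.r.degree) (hhi : s.r.degree < 2 * p) (hS : p ≤ degIn S s.r) :
    coeff (step p S j b s).r (step p S j b s).F ≠ 0 := by
  change coeff (step p S j b s).r (deletePthPowers p (pointTransform p S j b s)) ≠ 0
  rw [coeff_deletePthPowers,
    if_neg (not_isPthPowerExponent_step_r p hj b hbj hbN s hr hord hlo hhi hS)]
  exact coeff_newMult_pointTransform_ne_zero p hj b hbj hbN s hr hord hS

omit hp [CharP K p] in
/-- **[OURS · L1 W4.6] Stability: the new order is `|r'|`** — a terminal state blown up along ANY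
permissible coordinate centre inside the window is terminal again at every point over the origin.  NOT a
statement of the manuscript. [folklore] -/
theorem ordZero_step_eq {S : Finset σ} {j : σ} (hj : j ∈ S) (b : σ → K) (hbj : b j = 0)
    (hbN : ∀ i, i ∉ S → b i = 0) (s : CState σ K) (hr : ∀ d ∈ s.F.support, s.r ≤ d)
    (hord : ordZero s.F = (s.r.degree : ℕ)) (hlo : p < s.r.degree) (hhi : s.r.degree < 2 * p)
    (hS : p ≤ degIn S s.r) :
    ordZero (step p S j b s).F = ((step p S j b s).r.degree : ℕ) := by
  refine le_antisymm (ordZero_le_of_coeff_ne_zero _ _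
    (coeff_newMult_step_ne_zero p hj b hbj hbN s hr hord hlo hhi hS)) ?_
  refine le_ordZero_of_forall _ _ fun E hE => ?_
  exact PointBlowup.degree_le_degree_of_le (newMult_le_of_mem_support_step p S j b hbj s hord hr
    (perm_of_terminal S s hr) E (MvPolynomial.mem_support_iff.mpr hE))

omit hp [CharP K p] in
/-- **[OURS · L1 W4.6] … and the new shade is `0`.**  NOT a statement of the manuscript. [folklore] -/
theorem shade_step_eq_zero {S : Finset σ} {j : σ} (hj : j ∈ S) (b : σ → K) (hbj : b j = 0)
    (hbN : ∀ i, i ∉ S → b i = 0) (s : CState σ K) (hr : ∀ d ∈ s.F.support, s.r ≤ d)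
    (hord : ordZero s.F = (s.r.degree : ℕ)) (hlo : p < s.r.degree) (hhi : s.r.degree < 2 * p)
    (hS : p ≤ degIn S s.r) :
    (step p S j b s).shade = 0 := by
  unfold CState.shade
  rw [ordZero_step_eq p hj b hbj hbN s hr hord hlo hhi hS, tsub_self]

omit hp [CharP K p] in
/-- **[OURS · L1 W4.6] The order DROPS: `|r'| < |r|`** at every point over the origin of the blow-up of a
minimal centre (minimality at the chart index suffices: `Σ_{S∖{j}} r < p`), for any terminal state with
`Σ_S r ≥ p`.  NOT a statement of the manuscript. [folklore] -/
theorem degree_step_r_lt (S : Finset σ) (j : σ) (b : σ → K) (hbj : b j = 0) (s : CState σ K)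
    (hr : ∀ d ∈ s.F.support, s.r ≤ d) (hord : ordZero s.F = (s.r.degree : ℕ))
    (hS : p ≤ degIn S s.r) (hminj : degIn (S.erase j) s.r < p) :
    (step p S j b s).r.degree < s.r.degree := by
  classical
  have h1 : (step p S j b s).r.degree
      = (degIn S s.r - p) + ∑ i ∈ univ.erase j, (step p S j b s).r i := by
    rw [PointBlowup.degree_eq_add_sum_erase j, step_r_apply p S j b hbj s hr hord j, if_pos hbj,
      if_pos rfl]
  have h2 : ∑ i ∈ univ.erase j, (step p S j b s).r i ≤ ∑ i ∈ univ.erase j, s.r i := by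
    refine Finset.sum_le_sum fun i hi => ?_
    rw [step_r_apply p S j b hbj s hr hord i, if_neg (Finset.ne_of_mem_erase hi)]
    split_ifs
    · exact le_rfl
    · exact Nat.zero_le _
  have h3 := PointBlowup.degree_eq_add_sum_erase j s.r
  have h4 : degIn S s.r = s.r j + degIn (S.erase j) s.r := by
    by_cases hj : j ∈ S
    · unfold degIn; rw [← Finset.add_sum_erase S _ hj]
    · exfalso
      have : degIn (S.erase j) s.r = degIn S s.r := by rw [Finset.erase_eq_of_notMem hj]
      omega
  omega

omit hp [CharP K p] in
/-- Inside the window a permissible-centre step of a terminal state has `r' ≠ 0`. [folklore] -/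
theorem step_r_ne_zero {S : Finset σ} {j : σ} (hj : j ∈ S) (b : σ → K) (hbj : b j = 0)
    (hbN : ∀ i, i ∉ S → b i = 0) (s : CState σ K) (hr : ∀ d ∈ s.F.support, s.r ≤ d)
    (hord : ordZero s.F = (s.r.degree : ℕ)) (hlo : p < s.r.degree) (hhi : s.r.degree < 2 * p)
    (hS : p ≤ degIn S s.r) :
    (step p S j b s).r ≠ 0 := by
  intro h0
  apply not_isPthPowerExponent_step_r p hj b hbj hbN s hr hord hlo hhi hS
  rw [h0, isPthPowerExponent_iff]
  intro i
  exact dvd_zero p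

omit hp [CharP K p] in
/-- **[OURS · L1 W4.6] The equimultiplicity test above a permissible coordinate centre inside the window:
`p ≤ |r'|`.**  NOT a statement of the manuscript. [folklore] -/
theorem isEquimultiplePoint_iff {S : Finset σ} {j : σ} (hj : j ∈ S) (b : σ → K) (hbj : b j = 0)
    (hbN : ∀ i, i ∉ S → b i = 0) (s : CState σ K) (hr : ∀ d ∈ s.F.support, s.r ≤ d)
    (hord : ordZero s.F = (s.r.degree : ℕ)) (hlo : p < s.r.degree) (hhi : s.r.degree < 2 * p)
    (hS : p ≤ degIn S s.r) :
    IsEquimultiplePoint p S j b s ↔ p ≤ (step p S j b s).r.degree := by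
  classical
  constructor
  · intro heq
    by_contra hlt
    exact coeff_newMult_pointTransform_ne_zero p hj b hbj hbN s hr hord hS
      (heq _ (step_r_ne_zero p hj b hbj hbN s hr hord hlo hhi hS) (not_le.mp hlt))
  · intro hle d hd0 hdeg
    by_contra hne
    rw [pointTransform_eq_sum, coeff_sum] at hne
    obtain ⟨e, he, hne'⟩ := Finset.exists_ne_zero_of_sum_ne_zero hne
    have hce : ∀ i, chartExponent p S j e i = if i = j then degIn S e - p else e i := by
      intro i; unfold chartExponent; rw [Finsupp.update_apply]
    have hrd : (step p S j b s).r ≤ d := by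
      rw [Finsupp.le_def]
      intro i
      rw [step_r_apply p S j b hbj s hr hord i]
      by_cases hbi : b i = 0
      · rw [if_pos hbi]
        have heq : d i = chartExponent p S j e i :=
          PointBlowup.apply_eq_of_coeff_translate_monomial_ne_zero b hbi hne'
        rw [heq, hce]
        have h1 := degIn_le_degIn_of_le S (hr e he)
        have h2 := Finsupp.le_def.mp (hr e he) i
        by_cases hij : i = j
        · rw [if_pos hij, if_pos hij]; omega
        · rw [if_neg hij, if_neg hij]; exact h2
      · rw [if_neg hbi]; exact Nat.zero_le _
    have := PointBlowup.degree_le_degree_of_le hrd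
    omega

end Summit.ResolutionOfSingularities.ResolutionOfSingularities.Theorems.CampaignW46.MohWindowShadeTerminalCentres
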